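import Summits.QuantumFields.YangMills.Theorems.BalabanUVNodesN05SubBP2DSlotExistsOfThm33JunctionHWithQQP
import Summits.QuantumFields.YangMills.Theorems.BalabanUVNodesN05AtRecord13SubBP2DSepCoPH
import Literature.MathematicalPhysics.QuantumFieldTheory.Balaban1983to89.Node00.Record13CarriersB8SubBP2DCoPHG

/-!
# BalabanUVNodes ∕ N05 ([B8], `Dag.B8_main`) AT THE STAGE-13 RECORD OF RECORD — PRINT'S BACKGROUND (v1.7 key `SepCoPH`), «P₂D» PIN, SC-BINDING: N05 IN ∃-CURRENCY AT THE
# ONE-PIN CoPH RECORD `Node00.IsRecordOfRecord₁₃CSepCoPHSB8subBP₂D` (§1) AND IN THE `b8`-GENERIC S-CLASS `Node00.IsRecordOfRecord₁₃CSepCoPHG` (§2) FROM [4] THM 3.1's LETTERS,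
# N06's THEOREM 3.3 AS PRINTED (`B9.Thm33Printed`, BY NAME) AND dag-n06-b's JUNCTION DICTIONARY BINDERS — the CoPH-keyed record images of dag-n05-d g13's junction-applied N05
# row `BalabanUVNodesN05SubBP2DSlotExistsOfThm33JunctionH{,WithQQP}.exists_residB8_b8LeafOfRecordSubBP₂D_cutSubBP₅_of_letters_thm33_junctionH{,_withQQP}`
# (sibling of dag-n05-d's Sep-keyed `…N05AtRecord13SubBP2DSepOfThm33JunctionH` and of this seat's sockets-fed `…N05AtRecord13SubBP2DSepCoPHOfSocketsGammaPrime`)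

Track A of `YM-PLAN.md` (cell `pub-ymgap`, HUMAN RULING D-0062 ∕ D-0149 width seats), node **N05** = [Balaban1985RegularSpaces] Lemma 1, Thm 2, Prop 3, Thm 4, Props 5–7,
Thm 8, in-edge **N06** = [Balaban1985BackgroundPropagators]; width seat `pub-ymgap-dag-n05-w4` (g3), 2026-08-28, key item K1⁹ `StabilityBRunRowsAtRecordR13SepCoPHV`
(dag-lead KEY MAP v2; `--supports`, helper; count-neutral).  CLAIM-6 on dag-n05-d g13's FYI «CoPH ∕ G ∕ X-view images of B∕C are yours» (cell bus 2026-08-28 10:46Z ∕ 10:58Z).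

WHY.  The sockets-fed images (`…OfSocketsGammaPrime`, p625756 ∕ p626726) display FIVE [4]-type families; dag-n05-d g13's FILE B ∕ FILE C SUPPLY the three b9 socket families
(`SB9P ∕ SH59src ∕ SB9srcHP`) from N06's Theorem 3.3 AS PRINTED through dag-n06-b's junction member suppliers (`BalabanUVNodesN05JunctionHMemberSuppliers`, p625206), so the
N05 row `∃ lam c₁ ρ₀, B8LeafOfRecordSubBP₂D θ₃ (lam.cutSubBP₅ c₁ ρ₀)` is displayed modulo [4] Thm 3.1's letters `SLet ∕ SLetUB`, `B9.Thm33Printed c35 geo bg Gp GA` (N06's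
statement of record) and the junction's guarded dictionary binders only (FILE C: the averaging binder `havg` DISCHARGED by the genuine letter `withQQP`, dag-n05-w2's outright
box law on `IdxB8SubD`).  THIS FILE reads those two rows at the one-pin CoPH «P₂D» record (the K1 key is CoPH) and in the `b8`-generic S-class — `obtain` + `exact` each.

* §1 ★ `exists_isRecordOfRecord₁₃CSepCoPHSB8subBP₂D_b8_of_letters_thm33_junctionH` ∕ ★ `…_withQQP` — for `θ : Stage13HParams F N` with `Provisos₁₃SepCoPH`, `Admissible`,
  `5 ≤ L`, window `0 < γw ≤ θ.γ`, and FILE B's (resp. FILE C's) hypotheses VERBATIM over `θ.toStage3Params`: `∃ lam c₁ ρ₀ w w′` — the record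
  `IsRecordOfRecord₁₃CSepCoPHSB8subBP₂D F N (datumOfRecord₁₃SepCoPH F N θ h) w` bound at `θ.pinB8SubBP₂D (lam.cutSubBP₅ c₁ ρ₀)`, `w.C ∕ w.γ = γw ∕ w.L`, EVERY run's `b8` leaf and
  `Dag.B8_main`, and the same-datum `₁₃CSepCoPH` companion `w′` (= FILE B∕C ∘ this seat's `…N05AtRecord13SubBP2DSepCoPH.exists_isRecordOfRecord₁₃CSepCoPHSB8subBP₂D_b8_of_leaf`, p623386).
* §2 ★ `exists_isRecordOfRecord₁₃CSepCoPHG_b8_of_letters_thm33_junctionH` ∕ ★ `…_withQQP` — the same rows in the `b8`-GENERIC S-class (through dag-n05-w1 g2's G-slice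
  `Record13CarriersB8SubBP2DCoPHG.isRecordOfRecord₁₃CSepCoPHG_of_isRecordOfRecord₁₃CSepCoPHSB8subBP₂D`, p621632).
HONEST FRAMING: kernel bookkeeping by name; NO estimate; nothing of [Balaban1985RegularSpaces] ∕ [Balaban1985BackgroundPropagators] asserted — `B9.Thm33Printed` is N06's statement
(unproved here, a HYPOTHESIS), the junction dictionary binders (`DictAt ∕ Prop6At ∕ InvAtH ∕ CurvAtInAk ∕ LandauAt ∕ AvgAtP ∕ HolderAtδ2 ∕ LinBddAt ∕ SrcAt ∕ SrcHolderAtδ2`) and [4]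
Thm 3.1's letters `SLet ∕ SLetUB` are HYPOTHESES (N06 object layer at `m ≥ 1`, OPEN; satisfiability class-wise NOT claimed; no positive A6 witness claimed); `5 ≤ L` a guard;
Proposition 7 inside the slot in the repaired currency `c₇OfRecord θ₃` (WATCH-P7-CURRENCY-RECORD); count-neutral; **N05 NOT discharged**; K1 NOT claimed; no count claim; Bałaban AS
PRINTED with locators; one finite 𝕋⁴ programme at fixed ε — the Yang–Mills mass gap (Clay) is NOT proved by any of this; R4 closes the conditional finite-𝕋⁴ rung `BalabanLadder.UV`
only; nothing continuum ∕ ℝ⁴ ∕ OS.  No `sorry`, no new definition, no `instance`, no `notation`.  Unit `pub-ymgap-dag-n05-w4` (g3), 2026-08-28.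
[cite: Balaban1985RegularSpaces, Lemma 1 – Thm 8 pp.79–101, Thm 8 (1.146) p.101, (1.3)–(1.5) p.77; Balaban1985BackgroundPropagators, Thm 3.1 p.397, Thm 3.3 p.399, (3.42)–(3.47) pp.397–398; Balaban1989LargeFieldII, Thm 1 + (0.1) pp.355–356 (bookkeeping)]
-/

noncomputable section

namespace Summit.QuantumFields.YangMills.BalabanUVNodes.N05AtRecord13SubBP2DSepCoPHOfThm33JunctionH


open Literature.MathematicalPhysics.QuantumFieldTheory.Balaban1983to89
open Literature.MathematicalPhysics.QuantumFieldTheory.Balaban1983to89.Node00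
open Literature.MathematicalPhysics.QuantumFieldTheory.Balaban1983to89.T4Continuum
open Literature.MathematicalPhysics.QuantumFieldTheory.Balaban1983to89.DagBinding
open Literature.MathematicalPhysics.QuantumFieldTheory.Balaban1983to89.B8IdxB8LawsB (IdxB8LawsB IdxB8SubB)
open Literature.MathematicalPhysics.QuantumFieldTheory.Balaban1983to89.B8LeafModelZd (ZdIdx)
open Literature.MathematicalPhysics.QuantumFieldTheory.Balaban1983to89.B8LeafModelZd3 (SockB9P3)
open Literature.MathematicalPhysics.QuantumFieldTheory.Balaban1983to89.B9SupplySockB9P3ZdGammaUnivDelta2 (SockB9P3H2)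
open Literature.MathematicalPhysics.QuantumFieldTheory.Balaban1983to89.B8LeafModelZd3P (zdGF3P zdGF3HP)
open Literature.MathematicalPhysics.QuantumFieldTheory.Balaban1983to89.B8LeafModelZd3P2 (zdGF3P₂ zdGF3HP₂)
open Literature.MathematicalPhysics.QuantumFieldTheory.Balaban1983to89.B8TowerBondsPrinted (towerBondsP)
open Literature.MathematicalPhysics.QuantumFieldTheory.Balaban1983to89.B8SockLettersRD (SockLettersRD)
open Literature.MathematicalPhysics.QuantumFieldTheory.Balaban1983to89.B8Lemma1NonAbelian (mulCfg blockPairNA)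
open Literature.MathematicalPhysics.QuantumFieldTheory.Balaban1983to89.B8LanF146 (LanF146)
open Literature.MathematicalPhysics.QuantumFieldTheory.Balaban1983to89.B8Eq138LandauZd (covLap QT InR138 IsLandau146W)
open Literature.MathematicalPhysics.QuantumFieldTheory.Balaban1983to89.B8Prop5LandauDataZd (ZdLanIdx zdLan)
open Literature.MathematicalPhysics.QuantumFieldTheory.Balaban1983to89.B9SupplySockB9P3ZdLetters (OpsZd)
open Literature.MathematicalPhysics.QuantumFieldTheory.Balaban1983to89.B9SupplySockB9P3ZdAt (DictAt Prop6At LandauAt SrcAt)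
open Literature.MathematicalPhysics.QuantumFieldTheory.Balaban1983to89.B9SupplySockB9P3ZdAtLin (LinBddAt)
open Literature.MathematicalPhysics.QuantumFieldTheory.Balaban1983to89.B9SupplySockB9P3ZdGammaUniv (AvgAtP)
open Literature.MathematicalPhysics.QuantumFieldTheory.Balaban1983to89.B9SupplySockB9P3ZdGammaInAk (CurvAtInAk)
open Literature.MathematicalPhysics.QuantumFieldTheory.Balaban1983to89.B9SupplySockB9P3ZdGammaUnivDelta2 (HolderAtδ2)
open Literature.MathematicalPhysics.QuantumFieldTheory.Balaban1983to89.B9SupplySockB9P3ZdAtHerm (InvAtH)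
open Literature.MathematicalPhysics.QuantumFieldTheory.Balaban1983to89.B9SupplySockB9P3ZdGammaUnivDelta2Src (SrcHolderAtδ2)
open Literature.MathematicalPhysics.QuantumFieldTheory.Balaban1983to89.B9Eq316AveragingTransposeZd (qQ betaTau)
open Literature.MathematicalPhysics.QuantumFieldTheory.Balaban1983to89.B9Eq316AveragingTransposeZdPrinted (withQQP)
open Summit.QuantumFields.YangMills.BalabanUVNodes.N05SubBP2DSlotExistsOfThm33JunctionH (exists_residB8_b8LeafOfRecordSubBP₂D_cutSubBP₅_of_letters_thm33_junctionH)
open Summit.QuantumFields.YangMills.BalabanUVNodes.N05SubBP2DSlotExistsOfThm33JunctionHWithQQP (exists_residB8_b8LeafOfRecordSubBP₂D_cutSubBP₅_of_letters_thm33_junctionH_withQQP)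
open MatrixLog B7Prop1Explicit B7Prop2Explicit B7Prop1Local B7Eq92Concrete
open B8Ineq130 (tlo thi)
open B8Ineq132 (InAk covDerivFwd)
open B7Eq78Linearization (zdBlocking QprimeIter)
open B8Eq119TwistedAxial (bgT Restr129 InAx)
open B8Eq140Level (SideTouches)
open B8Eq1117Concrete (XSpace)
open B8Prop5ContractionKLevel (Bd2)
open B8LambdaSpaceKLevel (wt)
open B8Eq184Proof (gaugeExp cfgExp)
open B8Eq146AExpansion (iEta plaqCovDeriv)
open B8Eq143PlaqExpansion (pdiv)
open B7Prop4GeneralLevels (linCovIter)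
open B8Eq155JBound (Jcur wsup)
open B8ScaledSupNorm (bondNorm msup Bdd)
open B9Eq340HolderZd (hquot AdmPair)
open scoped Matrix.Norms.L2Operator

-- `Site` alone could resolve to the torus sites of `Setup.lean`; re-export the `ℤ^d` sites of `B7Prop1Explicit`.
export B7Prop1Explicit (Site)
open Summit.QuantumFields.YangMills.BalabanUVNodes.N05AtRecord13SubBP2DSepCoPH (exists_isRecordOfRecord₁₃CSepCoPHSB8subBP₂D_b8_of_leaf)

/-! ## §1. N05 in ∃-currency at the one-pin CoPH «P₂D» record, from [4] Thm 3.1's letters + `Thm33Printed` + the junction binders (FILE B ∕ FILE C ∘ this seat's slot closer) -/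

section AtRecordCoPH

variable {F : T4Family} {N : ℕ} [NeZero N]

/-- ★ **N05 AT THE ONE-PIN CoPH «P₂D» RECORD OF EVERY ADMISSIBLE PARAMETER FROM [4] THM 3.1's LETTERS, N06's THEOREM 3.3 AS PRINTED AND THE JUNCTION BINDERS** (image of
dag-n05-d g13's FILE B `exists_residB8_b8LeafOfRecordSubBP₂D_cutSubBP₅_of_letters_thm33_junctionH` at the CoPH record; ∃-currency over the P₅-pinned cut layer and the world; same-datum
`₁₃CSepCoPH` companion).  Proof: FILE B (`2 ≤ D` from admissibility) ∘ `exists_isRecordOfRecord₁₃CSepCoPHSB8subBP₂D_b8_of_leaf`.  `Thm33Printed`, the junction binders and [4] Thm 3.1's letters are HYPOTHESES (N06 content, m ≥ 1 OPEN); N05 NOT discharged.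
[cite: Balaban1985RegularSpaces, Lemma 1 – Thm 8 pp.79–101, Thm 8 (1.146) p.101, (1.3)–(1.5) p.77; Balaban1985BackgroundPropagators, Thm 3.1 p.397, Thm 3.3 p.399, (3.42)–(3.47) pp.397–398; Balaban1989LargeFieldII, Thm 1 + (0.1) pp.355–356 (bookkeeping)] -/
theorem exists_isRecordOfRecord₁₃CSepCoPHSB8subBP₂D_b8_of_letters_thm33_junctionH (θ : Stage13HParams F N) (h : θ.Provisos₁₃SepCoPH F N) (hθ : θ.Admissible F N)
    (hL5 : 5 ≤ θ.toStage3Params.L) {γw : ℝ} (hγ0 : 0 < γw) (hγ1 : γw ≤ θ.γ)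
    -- [Balaban1985BackgroundPropagators] Thm 3.1's letter bounds and threshold
    {B₀'H B₂' BG BR cL : ℝ} (hB₀'H : 0 < B₀'H) (hB₂' : 0 ≤ B₂') (hBG : 0 ≤ BG) (hBR : 0 ≤ BR) (hcL : 0 < cL)
    -- [4]'s letters AT THE (1.3)–(1.5)-ADMISSIBLE `Ω₀ = ℤᵈ` LAW MEMBERS (p619291's texts verbatim): existence side and uniqueness side
    (SLet : ∀ i : ZdIdx θ.toStage3Params.D θ.toStage3Params.L, i.Ω 0 = Set.univ → IdxB8LawsB θ.toStage3Params.L i → B8ConstraintBonds.DomainSeq θ.toStage3Params.L i.Ω → (∀ l, l < i.k → ∀ z ∈ i.Λs i.k l, ((θ.toStage3Params.L : ℤ) ^ l) • z ∈ B8ConstraintBonds.Lam θ.toStage3Params.L i.Ω l) → SockLettersRD (𝔸 := θ.toStage3Params.𝔸) θ.toStage3Params.L BG BR B₀'H B₂' cL i.η i.k i.Ω i.Λs)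
    (SLetUB : ∀ i : ZdIdx θ.toStage3Params.D θ.toStage3Params.L, i.Ω 0 = Set.univ → IdxB8LawsB θ.toStage3Params.L i → B8ConstraintBonds.DomainSeq θ.toStage3Params.L i.Ω → (∀ l, l < i.k → ∀ z ∈ i.Λs i.k l, ((θ.toStage3Params.L : ℤ) ^ l) • z ∈ B8ConstraintBonds.Lam θ.toStage3Params.L i.Ω l) → ∀ α₀ : ℝ, 0 < α₀ → α₀ ≤ cL → ∀ U₀ : Site θ.toStage3Params.D → Fin θ.toStage3Params.D → θ.toStage3Params.𝔸ˣ, (∀ x κ, U₀ x κ ∈ unitaryUnits θ.toStage3Params.𝔸) →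
      InAk θ.toStage3Params.L i.k i.η α₀ i.Ω U₀ →
      ∃ (g Δ : (Site θ.toStage3Params.D → θ.toStage3Params.𝔸) →ₗ[ℂ] (Site θ.toStage3Params.D → θ.toStage3Params.𝔸)) (q : (Site θ.toStage3Params.D → θ.toStage3Params.𝔸) →ₗ[ℂ] (ℕ → Site θ.toStage3Params.D → θ.toStage3Params.𝔸))
        (qs : (ℕ → Site θ.toStage3Params.D → θ.toStage3Params.𝔸) →ₗ[ℂ] (Site θ.toStage3Params.D → θ.toStage3Params.𝔸)) (Aw c : (ℕ → Site θ.toStage3Params.D → θ.toStage3Params.𝔸) →ₗ[ℂ] (ℕ → Site θ.toStage3Params.D → θ.toStage3Params.𝔸))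
        (H' : XSpace θ.toStage3Params.D i.k θ.toStage3Params.𝔸 →ₗ[ℂ] (Site θ.toStage3Params.D → θ.toStage3Params.𝔸)),
        (∀ x : Site θ.toStage3Params.D → θ.toStage3Params.𝔸, (∃ C : ℝ, ∀ y, ‖x y‖ ≤ C) → g (Δ x + qs (Aw (q x))) = x) ∧ (∀ φ, qs (c (q (g (g (qs φ))))) = qs φ) ∧
        (∀ (f : Site θ.toStage3Params.D → θ.toStage3Params.𝔸), ∀ x ∈ i.Ω 0, Δ f x = covLap i.η U₀ ((i.Ω 0).indicator f) x) ∧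
        (∀ (μ : ℕ → Site θ.toStage3Params.D → θ.toStage3Params.𝔸), ∀ x ∈ i.Ω 0, qs μ x = QT θ.toStage3Params.L i.k (i.Λs i.k) U₀ μ x) ∧
        (∀ (f : Site θ.toStage3Params.D → θ.toStage3Params.𝔸) (n : ℕ), n ≤ i.k → ∀ y ∈ i.Λs i.k n, q f n y = QprimeIter (zdBlocking θ.toStage3Params.D θ.toStage3Params.L) (bgT θ.toStage3Params.L U₀) n f y) ∧
        (∀ (f : Site θ.toStage3Params.D → θ.toStage3Params.𝔸) (n : ℕ) (y : Site θ.toStage3Params.D), ¬ (n ≤ i.k ∧ y ∈ i.Λs i.k n) → q f n y = 0) ∧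
        (∀ (X : XSpace θ.toStage3Params.D i.k θ.toStage3Params.𝔸) (x : Site θ.toStage3Params.D), ‖H' X x‖ ≤ B₀'H * ‖X‖) ∧
        (∀ n, n ≤ i.k → ∀ (X : XSpace θ.toStage3Params.D i.k θ.toStage3Params.𝔸), ∀ p ∈ {b : Site θ.toStage3Params.D × Fin θ.toStage3Params.D | SideTouches (i.Ω n) b.1 b.2},
          wt θ.toStage3Params.L i.η n * ‖covDerivFwd i.η U₀ p.2 (H' X) p.1‖ ≤ B₀'H * ‖X‖) ∧
        (∀ X : XSpace θ.toStage3Params.D i.k θ.toStage3Params.𝔸, Bd2 θ.toStage3Params.L i.η i.k i.Ω (covLap i.η U₀ (H' X)) (B₂' * ‖X‖)) ∧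
        (∀ (Y : XSpace θ.toStage3Params.D i.k θ.toStage3Params.𝔸) (n : ℕ) (hn : n ≤ i.k) (y : Site θ.toStage3Params.D), y ∈ i.Λs i.k n →
          QprimeIter (zdBlocking θ.toStage3Params.D θ.toStage3Params.L) (bgT θ.toStage3Params.L U₀) n (H' Y) y = Y (⟨n, Nat.lt_succ_of_le hn⟩, y)) ∧
        (∀ (f : Site θ.toStage3Params.D → θ.toStage3Params.𝔸) (r : ℝ), 0 ≤ r → Bd2 θ.toStage3Params.L i.η i.k i.Ω f r →
          (∀ x, ‖g f x‖ ≤ BG * r) ∧ ∀ n, n ≤ i.k → ∀ p ∈ {b : Site θ.toStage3Params.D × Fin θ.toStage3Params.D | SideTouches (i.Ω n) b.1 b.2},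
            wt θ.toStage3Params.L i.η n * ‖covDerivFwd i.η U₀ p.2 (g f) p.1‖ ≤ BG * r) ∧
        (∀ (f : Site θ.toStage3Params.D → θ.toStage3Params.𝔸) (r : ℝ), 0 ≤ r → Bd2 θ.toStage3Params.L i.η i.k i.Ω f r → Bd2 θ.toStage3Params.L i.η i.k i.Ω (f - g (qs (c (q (g f))))) (BR * r)))
    -- N06's FRAME for [4] Thm 3.3 (any index type, geometries, backgrounds, the two kernel families of Thms 3.1–3.3) and its `ℤᵈ` dictionary maps
    {I : Type} (geo : I → B9.Geometry) (bg : I → B9.Backgrounds) (Gp GA : ∀ i, B9.KernelFamily (geo i) (bg i))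
    (mem : ℝ → ZdIdx θ.toStage3Params.D θ.toStage3Params.L → ℕ → I)
    (ιCfg : ∀ (M : ℝ) (i : ZdIdx θ.toStage3Params.D θ.toStage3Params.L) (m : ℕ) (U₀ : Site θ.toStage3Params.D → Fin θ.toStage3Params.D → θ.toStage3Params.𝔸ˣ), (∀ x κ, U₀ x κ ∈ unitaryUnits θ.toStage3Params.𝔸) → (bg (mem M i m)).Cfg)
    (ιLoc : ∀ (M : ℝ) (i : ZdIdx θ.toStage3Params.D θ.toStage3Params.L) (m : ℕ), (Site θ.toStage3Params.D → Fin θ.toStage3Params.D → θ.toStage3Params.𝔸) → (geo (mem M i m)).Loc)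
    (ops : ℝ → ZdIdx θ.toStage3Params.D θ.toStage3Params.L → ℕ → OpsZd θ.toStage3Params.D θ.toStage3Params.𝔸)
    {c35 c₆ K₆ M₃ a₃ c69 q β cS cSβ : ℝ} {CH : ℝ → ℝ} {len : Site θ.toStage3Params.D → ℝ}
    -- N06's THEOREM 3.3 AS PRINTED, by name
    (h33 : B9.Thm33Printed c35 geo bg Gp GA)
    -- dag-n06-b's JUNCTION DICTIONARY BINDERS at the (1.3)–(1.5)-admissible members, guarded (N06 object layer; HYPOTHESES)
    (hdict : ∀ (M : ℝ) (j : IdxB8SubD θ.toStage3Params) (m : ℕ), 1 ≤ M → M₃ ≤ M → m ≤ j.1.1.1.1.k → DictAt geo bg GA θ.toStage3Params.L mem ιCfg ιLoc ops M j.1.1.1.1 m)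
    (hP6 : ∀ (M : ℝ) (j : IdxB8SubD θ.toStage3Params) (m : ℕ), 1 ≤ M → M₃ ≤ M → m ≤ j.1.1.1.1.k → Prop6At bg θ.toStage3Params.L mem ιCfg c35 c₆ K₆ M j.1.1.1.1 m)
    (hinv : ∀ (M : ℝ) (j : IdxB8SubD θ.toStage3Params) (m : ℕ), 1 ≤ M → M₃ ≤ M → m ≤ j.1.1.1.1.k → InvAtH bg θ.toStage3Params.L mem ιCfg ops c35 a₃ M j.1.1.1.1 m)
    (hcurv : ∀ (M : ℝ) (j : IdxB8SubD θ.toStage3Params) (m : ℕ), 1 ≤ M → M₃ ≤ M → m ≤ j.1.1.1.1.k → CurvAtInAk θ.toStage3Params.L ops c69 M j.1.1.1.1 m)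
    (hlan : ∀ (M : ℝ) (j : IdxB8SubD θ.toStage3Params) (m : ℕ), 1 ≤ M → M₃ ≤ M → m ≤ j.1.1.1.1.k → LandauAt bg θ.toStage3Params.L mem ιCfg ops c35 a₃ M j.1.1.1.1 m)
    (havg : ∀ (M : ℝ) (j : IdxB8SubD θ.toStage3Params) (m : ℕ), 1 ≤ M → M₃ ≤ M → m ≤ j.1.1.1.1.k →
      AvgAtP θ.toStage3Params.L ops q (fun m' l => towerBondsP θ.toStage3Params.L j.1.1.1.1.Ω (j.1.1.1.1.Λs m') l) M j.1.1.1.1 m)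
    (hhol : ∀ (M : ℝ) (j : IdxB8SubD θ.toStage3Params) (m : ℕ), 1 ≤ M → M₃ ≤ M → m ≤ j.1.1.1.1.k → HolderAtδ2 geo bg GA θ.toStage3Params.L mem ιCfg ops β len CH M j.1.1.1.1 m)
    (hlin : ∀ (M : ℝ) (j : IdxB8SubD θ.toStage3Params) (m : ℕ), 1 ≤ M → M₃ ≤ M → m ≤ j.1.1.1.1.k → LinBddAt θ.toStage3Params.L ops M j.1.1.1.1 m)
    (hsrc : ∀ (M : ℝ) (j : IdxB8SubD θ.toStage3Params) (m : ℕ), 1 ≤ M → M₃ ≤ M → m ≤ j.1.1.1.1.k → SrcAt bg θ.toStage3Params.L mem ιCfg ops c35 a₃ cS M j.1.1.1.1 m)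
    (hsrcH : ∀ (M : ℝ) (j : IdxB8SubD θ.toStage3Params) (m : ℕ), 1 ≤ M → M₃ ≤ M → m ≤ j.1.1.1.1.k → SrcHolderAtδ2 bg θ.toStage3Params.L mem ιCfg ops c35 a₃ β len cSβ M j.1.1.1.1 m)
    -- the junction's primitive constants ([4] (3.35)∕Prop. 6 `c₆ K₆`, (3.27) `a₃`, (3.69) `c69`, (3.16) `q`, source `c_S c_Sβ`) and Theorem 8's source size factor `γ₈`
    (hc₆ : 0 < c₆) (hK₆ : 0 < K₆) (ha₃ : 0 < a₃) (hc69 : 0 ≤ c69) (hq : 0 ≤ q) (hcS : 0 ≤ cS) (hcSβ : 0 ≤ cSβ) {γ₈ : ℝ} (hγ₈ : 1 ≤ γ₈) :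
    ∃ (lam : ResidB8 θ.toStage3Params) (c₁ : ℝ) (ρ₀ : ℕ) (w w' : WorldP), IsRecordOfRecord₁₃CSepCoPHSB8subBP₂D F N (datumOfRecord₁₃SepCoPH F N θ h) w ∧
      w.C = (datumOfRecord₁₃SepCoPH F N θ h).C ∧ w.γ = γw ∧ w.L = (θ.L : ℝ) ∧
      (∀ P : B12.RunParams, w.up P = upOfRecord₅CSC F N ((θ.pinB8SubBP₂D F N (lam.cutSubBP₅ c₁ ρ₀)).toStage5₁₃CoPH F N) (c₇OfRecord θ.toStage3Params) P) ∧
      (∀ P : B12.RunParams, (leavesP w P).b8 ∧ Dag.B8_main (leavesP w P)) ∧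
      IsRecordOfRecord₁₃CSepCoPH F N (datumOfRecord₁₃SepCoPH F N θ h) w' ∧ w'.C = w.C ∧ w'.γ = w.γ ∧ w'.L = w.L ∧
      ∀ P : B12.RunParams, leavesP w P = { leavesP w' P with b8 := (leavesP w P).b8 } := by
  obtain ⟨lam, c₁, ρ₀, hslot⟩ := exists_residB8_b8LeafOfRecordSubBP₂D_cutSubBP₅_of_letters_thm33_junctionH θ.toStage3Params
    (hθ.toStage9.toStage8).1.1.1.1 hL5 hB₀'H hB₂' hBG hBR hcL SLet SLetUB geo bg Gp GA mem ιCfg ιLoc ops h33 hdict hP6 hinv hcurv hlan havg hhol hlin hsrc hsrcH hc₆ hK₆ ha₃ hc69 hq hcS hcSβ hγ₈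
  exact ⟨lam, c₁, ρ₀, exists_isRecordOfRecord₁₃CSepCoPHSB8subBP₂D_b8_of_leaf θ h hθ (lam.cutSubBP₅ c₁ ρ₀) hslot hγ0 hγ1⟩

/-- ★ **THE SAME WITH THE GENUINE AVERAGING LETTER** (image of FILE C `exists_residB8_b8LeafOfRecordSubBP₂D_cutSubBP₅_of_letters_thm33_junctionH_withQQP`: nine junction binders — NO `havg` —
`ops` pinned pointwise to dag-n06-b's `withQQP τ L (towerBondsP-class of the member) ops₀`; `θ.𝔸` finite-dimensional over `ℝ`, trace functional `τ`).  `Thm33Printed`, the junction binders and [4] Thm 3.1's letters are HYPOTHESES (N06 content, m ≥ 1 OPEN); N05 NOT discharged.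
[cite: Balaban1985RegularSpaces, Lemma 1 – Thm 8 pp.79–101, (1.31) p.82; Balaban1985BackgroundPropagators, (3.16) p.393, Thm 3.1 p.397, Thm 3.3 p.399; Balaban1989LargeFieldII, Thm 1 + (0.1) pp.355–356 (bookkeeping)] -/
theorem exists_isRecordOfRecord₁₃CSepCoPHSB8subBP₂D_b8_of_letters_thm33_junctionH_withQQP (θ : Stage13HParams F N) (h : θ.Provisos₁₃SepCoPH F N) (hθ : θ.Admissible F N)
    (hL5 : 5 ≤ θ.toStage3Params.L) {γw : ℝ} (hγ0 : 0 < γw) (hγ1 : γw ≤ θ.γ)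
    -- [Balaban1985BackgroundPropagators] Thm 3.1's letter bounds and threshold
    {B₀'H B₂' BG BR cL : ℝ} (hB₀'H : 0 < B₀'H) (hB₂' : 0 ≤ B₂') (hBG : 0 ≤ BG) (hBR : 0 ≤ BR) (hcL : 0 < cL)
    -- [4]'s letters AT THE (1.3)–(1.5)-ADMISSIBLE `Ω₀ = ℤᵈ` LAW MEMBERS (p619291's texts verbatim): existence side and uniqueness side
    (SLet : ∀ i : ZdIdx θ.toStage3Params.D θ.toStage3Params.L, i.Ω 0 = Set.univ → IdxB8LawsB θ.toStage3Params.L i → B8ConstraintBonds.DomainSeq θ.toStage3Params.L i.Ω → (∀ l, l < i.k → ∀ z ∈ i.Λs i.k l, ((θ.toStage3Params.L : ℤ) ^ l) • z ∈ B8ConstraintBonds.Lam θ.toStage3Params.L i.Ω l) → SockLettersRD (𝔸 := θ.toStage3Params.𝔸) θ.toStage3Params.L BG BR B₀'H B₂' cL i.η i.k i.Ω i.Λs)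
    (SLetUB : ∀ i : ZdIdx θ.toStage3Params.D θ.toStage3Params.L, i.Ω 0 = Set.univ → IdxB8LawsB θ.toStage3Params.L i → B8ConstraintBonds.DomainSeq θ.toStage3Params.L i.Ω → (∀ l, l < i.k → ∀ z ∈ i.Λs i.k l, ((θ.toStage3Params.L : ℤ) ^ l) • z ∈ B8ConstraintBonds.Lam θ.toStage3Params.L i.Ω l) → ∀ α₀ : ℝ, 0 < α₀ → α₀ ≤ cL → ∀ U₀ : Site θ.toStage3Params.D → Fin θ.toStage3Params.D → θ.toStage3Params.𝔸ˣ, (∀ x κ, U₀ x κ ∈ unitaryUnits θ.toStage3Params.𝔸) →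
      InAk θ.toStage3Params.L i.k i.η α₀ i.Ω U₀ →
      ∃ (g Δ : (Site θ.toStage3Params.D → θ.toStage3Params.𝔸) →ₗ[ℂ] (Site θ.toStage3Params.D → θ.toStage3Params.𝔸)) (q : (Site θ.toStage3Params.D → θ.toStage3Params.𝔸) →ₗ[ℂ] (ℕ → Site θ.toStage3Params.D → θ.toStage3Params.𝔸))
        (qs : (ℕ → Site θ.toStage3Params.D → θ.toStage3Params.𝔸) →ₗ[ℂ] (Site θ.toStage3Params.D → θ.toStage3Params.𝔸)) (Aw c : (ℕ → Site θ.toStage3Params.D → θ.toStage3Params.𝔸) →ₗ[ℂ] (ℕ → Site θ.toStage3Params.D → θ.toStage3Params.𝔸))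
        (H' : XSpace θ.toStage3Params.D i.k θ.toStage3Params.𝔸 →ₗ[ℂ] (Site θ.toStage3Params.D → θ.toStage3Params.𝔸)),
        (∀ x : Site θ.toStage3Params.D → θ.toStage3Params.𝔸, (∃ C : ℝ, ∀ y, ‖x y‖ ≤ C) → g (Δ x + qs (Aw (q x))) = x) ∧ (∀ φ, qs (c (q (g (g (qs φ))))) = qs φ) ∧
        (∀ (f : Site θ.toStage3Params.D → θ.toStage3Params.𝔸), ∀ x ∈ i.Ω 0, Δ f x = covLap i.η U₀ ((i.Ω 0).indicator f) x) ∧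
        (∀ (μ : ℕ → Site θ.toStage3Params.D → θ.toStage3Params.𝔸), ∀ x ∈ i.Ω 0, qs μ x = QT θ.toStage3Params.L i.k (i.Λs i.k) U₀ μ x) ∧
        (∀ (f : Site θ.toStage3Params.D → θ.toStage3Params.𝔸) (n : ℕ), n ≤ i.k → ∀ y ∈ i.Λs i.k n, q f n y = QprimeIter (zdBlocking θ.toStage3Params.D θ.toStage3Params.L) (bgT θ.toStage3Params.L U₀) n f y) ∧
        (∀ (f : Site θ.toStage3Params.D → θ.toStage3Params.𝔸) (n : ℕ) (y : Site θ.toStage3Params.D), ¬ (n ≤ i.k ∧ y ∈ i.Λs i.k n) → q f n y = 0) ∧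
        (∀ (X : XSpace θ.toStage3Params.D i.k θ.toStage3Params.𝔸) (x : Site θ.toStage3Params.D), ‖H' X x‖ ≤ B₀'H * ‖X‖) ∧
        (∀ n, n ≤ i.k → ∀ (X : XSpace θ.toStage3Params.D i.k θ.toStage3Params.𝔸), ∀ p ∈ {b : Site θ.toStage3Params.D × Fin θ.toStage3Params.D | SideTouches (i.Ω n) b.1 b.2},
          wt θ.toStage3Params.L i.η n * ‖covDerivFwd i.η U₀ p.2 (H' X) p.1‖ ≤ B₀'H * ‖X‖) ∧
        (∀ X : XSpace θ.toStage3Params.D i.k θ.toStage3Params.𝔸, Bd2 θ.toStage3Params.L i.η i.k i.Ω (covLap i.η U₀ (H' X)) (B₂' * ‖X‖)) ∧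
        (∀ (Y : XSpace θ.toStage3Params.D i.k θ.toStage3Params.𝔸) (n : ℕ) (hn : n ≤ i.k) (y : Site θ.toStage3Params.D), y ∈ i.Λs i.k n →
          QprimeIter (zdBlocking θ.toStage3Params.D θ.toStage3Params.L) (bgT θ.toStage3Params.L U₀) n (H' Y) y = Y (⟨n, Nat.lt_succ_of_le hn⟩, y)) ∧
        (∀ (f : Site θ.toStage3Params.D → θ.toStage3Params.𝔸) (r : ℝ), 0 ≤ r → Bd2 θ.toStage3Params.L i.η i.k i.Ω f r →
          (∀ x, ‖g f x‖ ≤ BG * r) ∧ ∀ n, n ≤ i.k → ∀ p ∈ {b : Site θ.toStage3Params.D × Fin θ.toStage3Params.D | SideTouches (i.Ω n) b.1 b.2},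
            wt θ.toStage3Params.L i.η n * ‖covDerivFwd i.η U₀ p.2 (g f) p.1‖ ≤ BG * r) ∧
        (∀ (f : Site θ.toStage3Params.D → θ.toStage3Params.𝔸) (r : ℝ), 0 ≤ r → Bd2 θ.toStage3Params.L i.η i.k i.Ω f r → Bd2 θ.toStage3Params.L i.η i.k i.Ω (f - g (qs (c (q (g f))))) (BR * r)))
    -- N06's FRAME for [4] Thm 3.3 (any index type, geometries, backgrounds, the two kernel families of Thms 3.1–3.3) and its `ℤᵈ` dictionary maps
    {I : Type} (geo : I → B9.Geometry) (bg : I → B9.Backgrounds) (Gp GA : ∀ i, B9.KernelFamily (geo i) (bg i))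
    (mem : ℝ → ZdIdx θ.toStage3Params.D θ.toStage3Params.L → ℕ → I)
    (ιCfg : ∀ (M : ℝ) (i : ZdIdx θ.toStage3Params.D θ.toStage3Params.L) (m : ℕ) (U₀ : Site θ.toStage3Params.D → Fin θ.toStage3Params.D → θ.toStage3Params.𝔸ˣ), (∀ x κ, U₀ x κ ∈ unitaryUnits θ.toStage3Params.𝔸) → (bg (mem M i m)).Cfg)
    (ιLoc : ∀ (M : ℝ) (i : ZdIdx θ.toStage3Params.D θ.toStage3Params.L) (m : ℕ), (Site θ.toStage3Params.D → Fin θ.toStage3Params.D → θ.toStage3Params.𝔸) → (geo (mem M i m)).Loc)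
    (ops : ℝ → ZdIdx θ.toStage3Params.D θ.toStage3Params.L → ℕ → OpsZd θ.toStage3Params.D θ.toStage3Params.𝔸)
    -- THE GENUINE AVERAGING LETTER: `ops` carries dag-n06-b's `withQQP` co-letter `(Q*Q)(U₀)` at print's class of the member ([4] (3.16); trace functional `τ`)
    [FiniteDimensional ℝ θ.toStage3Params.𝔸] (τ : θ.toStage3Params.𝔸 →ₗ[ℂ] ℂ) {Cτ : ℝ} (hCτ : ∀ x y : θ.toStage3Params.𝔸, |(τ (star x * y)).re| ≤ Cτ * ‖x‖ * ‖y‖)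
    (ops₀ : ℝ → ZdIdx θ.toStage3Params.D θ.toStage3Params.L → ℕ → OpsZd θ.toStage3Params.D θ.toStage3Params.𝔸)
    (hops : ∀ (M : ℝ) (i : ZdIdx θ.toStage3Params.D θ.toStage3Params.L) (m : ℕ), ops M i m = withQQP τ θ.toStage3Params.L (fun m' l => towerBondsP θ.toStage3Params.L i.Ω (i.Λs m') l) ops₀ M i m)
    {c35 c₆ K₆ M₃ a₃ c69 β cS cSβ : ℝ} {CH : ℝ → ℝ} {len : Site θ.toStage3Params.D → ℝ}
    -- N06's THEOREM 3.3 AS PRINTED, by name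
    (h33 : B9.Thm33Printed c35 geo bg Gp GA)
    -- dag-n06-b's JUNCTION DICTIONARY BINDERS at the (1.3)–(1.5)-admissible members, guarded (N06 object layer; HYPOTHESES) — NO `havg`
    (hdict : ∀ (M : ℝ) (j : IdxB8SubD θ.toStage3Params) (m : ℕ), 1 ≤ M → M₃ ≤ M → m ≤ j.1.1.1.1.k → DictAt geo bg GA θ.toStage3Params.L mem ιCfg ιLoc ops M j.1.1.1.1 m)
    (hP6 : ∀ (M : ℝ) (j : IdxB8SubD θ.toStage3Params) (m : ℕ), 1 ≤ M → M₃ ≤ M → m ≤ j.1.1.1.1.k → Prop6At bg θ.toStage3Params.L mem ιCfg c35 c₆ K₆ M j.1.1.1.1 m)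
    (hinv : ∀ (M : ℝ) (j : IdxB8SubD θ.toStage3Params) (m : ℕ), 1 ≤ M → M₃ ≤ M → m ≤ j.1.1.1.1.k → InvAtH bg θ.toStage3Params.L mem ιCfg ops c35 a₃ M j.1.1.1.1 m)
    (hcurv : ∀ (M : ℝ) (j : IdxB8SubD θ.toStage3Params) (m : ℕ), 1 ≤ M → M₃ ≤ M → m ≤ j.1.1.1.1.k → CurvAtInAk θ.toStage3Params.L ops c69 M j.1.1.1.1 m)
    (hlan : ∀ (M : ℝ) (j : IdxB8SubD θ.toStage3Params) (m : ℕ), 1 ≤ M → M₃ ≤ M → m ≤ j.1.1.1.1.k → LandauAt bg θ.toStage3Params.L mem ιCfg ops c35 a₃ M j.1.1.1.1 m)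
    (hhol : ∀ (M : ℝ) (j : IdxB8SubD θ.toStage3Params) (m : ℕ), 1 ≤ M → M₃ ≤ M → m ≤ j.1.1.1.1.k → HolderAtδ2 geo bg GA θ.toStage3Params.L mem ιCfg ops β len CH M j.1.1.1.1 m)
    (hlin : ∀ (M : ℝ) (j : IdxB8SubD θ.toStage3Params) (m : ℕ), 1 ≤ M → M₃ ≤ M → m ≤ j.1.1.1.1.k → LinBddAt θ.toStage3Params.L ops M j.1.1.1.1 m)
    (hsrc : ∀ (M : ℝ) (j : IdxB8SubD θ.toStage3Params) (m : ℕ), 1 ≤ M → M₃ ≤ M → m ≤ j.1.1.1.1.k → SrcAt bg θ.toStage3Params.L mem ιCfg ops c35 a₃ cS M j.1.1.1.1 m)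
    (hsrcH : ∀ (M : ℝ) (j : IdxB8SubD θ.toStage3Params) (m : ℕ), 1 ≤ M → M₃ ≤ M → m ≤ j.1.1.1.1.k → SrcHolderAtδ2 bg θ.toStage3Params.L mem ιCfg ops c35 a₃ β len cSβ M j.1.1.1.1 m)
    -- the junction's primitive constants ([4] (3.35)∕Prop. 6 `c₆ K₆`, (3.27) `a₃`, (3.69) `c69`, source `c_S c_Sβ`) and Theorem 8's source size factor `γ₈`
    (hc₆ : 0 < c₆) (hK₆ : 0 < K₆) (ha₃ : 0 < a₃) (hc69 : 0 ≤ c69) (hcS : 0 ≤ cS) (hcSβ : 0 ≤ cSβ) {γ₈ : ℝ} (hγ₈ : 1 ≤ γ₈) :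
    ∃ (lam : ResidB8 θ.toStage3Params) (c₁ : ℝ) (ρ₀ : ℕ) (w w' : WorldP), IsRecordOfRecord₁₃CSepCoPHSB8subBP₂D F N (datumOfRecord₁₃SepCoPH F N θ h) w ∧
      w.C = (datumOfRecord₁₃SepCoPH F N θ h).C ∧ w.γ = γw ∧ w.L = (θ.L : ℝ) ∧
      (∀ P : B12.RunParams, w.up P = upOfRecord₅CSC F N ((θ.pinB8SubBP₂D F N (lam.cutSubBP₅ c₁ ρ₀)).toStage5₁₃CoPH F N) (c₇OfRecord θ.toStage3Params) P) ∧
      (∀ P : B12.RunParams, (leavesP w P).b8 ∧ Dag.B8_main (leavesP w P)) ∧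
      IsRecordOfRecord₁₃CSepCoPH F N (datumOfRecord₁₃SepCoPH F N θ h) w' ∧ w'.C = w.C ∧ w'.γ = w.γ ∧ w'.L = w.L ∧
      ∀ P : B12.RunParams, leavesP w P = { leavesP w' P with b8 := (leavesP w P).b8 } := by
  obtain ⟨lam, c₁, ρ₀, hslot⟩ := exists_residB8_b8LeafOfRecordSubBP₂D_cutSubBP₅_of_letters_thm33_junctionH_withQQP θ.toStage3Params
    (hθ.toStage9.toStage8).1.1.1.1 hL5 hB₀'H hB₂' hBG hBR hcL SLet SLetUB geo bg Gp GA mem ιCfg ιLoc ops τ hCτ ops₀ hops h33 hdict hP6 hinv hcurv hlan hhol hlin hsrc hsrcH hc₆ hK₆ ha₃ hc69 hcS hcSβ hγ₈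
  exact ⟨lam, c₁, ρ₀, exists_isRecordOfRecord₁₃CSepCoPHSB8subBP₂D_b8_of_leaf θ h hθ (lam.cutSubBP₅ c₁ ρ₀) hslot hγ0 hγ1⟩

end AtRecordCoPH

/-! ## §2. … and in the `b8`-GENERIC S-class `IsRecordOfRecord₁₃CSepCoPHG` (through dag-n05-w1 g2's G-slice p621632) -/

section AtRecordG

variable {F : T4Family} {N : ℕ} [NeZero N]

/-- ★ **… IN THE `b8`-GENERIC S-CLASS** (FILE B's row): same hypotheses ⊢ a G-CLASS world at `datumOfRecord₁₃SepCoPH F N θ h` bound to the SC-binding over the [B8″P₂D]-pinned v1.7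
view at the P₅-pinned cut, `γ = γw`, every run's `b8` leaf and `Dag.B8_main` — END from nodes there is `endStatementBPrinted_of_isRecordOfRecord₁₃CSepCoPHG_of_nodes`.  `Thm33Printed`, the junction binders and [4] Thm 3.1's letters are HYPOTHESES (N06 content, m ≥ 1 OPEN); N05 NOT discharged.
[cite: Balaban1985RegularSpaces, Lemma 1 – Thm 8 pp.79–101, Thm 8 (1.146) p.101, (1.3)–(1.5) p.77; Balaban1985BackgroundPropagators, Thm 3.1 p.397, Thm 3.3 p.399, (3.42)–(3.47) pp.397–398; Balaban1989LargeFieldII, Thm 1 + (0.1) pp.355–356 (bookkeeping)] -/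
theorem exists_isRecordOfRecord₁₃CSepCoPHG_b8_of_letters_thm33_junctionH (θ : Stage13HParams F N) (h : θ.Provisos₁₃SepCoPH F N) (hθ : θ.Admissible F N)
    (hL5 : 5 ≤ θ.toStage3Params.L) {γw : ℝ} (hγ0 : 0 < γw) (hγ1 : γw ≤ θ.γ)
    -- [Balaban1985BackgroundPropagators] Thm 3.1's letter bounds and threshold
    {B₀'H B₂' BG BR cL : ℝ} (hB₀'H : 0 < B₀'H) (hB₂' : 0 ≤ B₂') (hBG : 0 ≤ BG) (hBR : 0 ≤ BR) (hcL : 0 < cL)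
    -- [4]'s letters AT THE (1.3)–(1.5)-ADMISSIBLE `Ω₀ = ℤᵈ` LAW MEMBERS (p619291's texts verbatim): existence side and uniqueness side
    (SLet : ∀ i : ZdIdx θ.toStage3Params.D θ.toStage3Params.L, i.Ω 0 = Set.univ → IdxB8LawsB θ.toStage3Params.L i → B8ConstraintBonds.DomainSeq θ.toStage3Params.L i.Ω → (∀ l, l < i.k → ∀ z ∈ i.Λs i.k l, ((θ.toStage3Params.L : ℤ) ^ l) • z ∈ B8ConstraintBonds.Lam θ.toStage3Params.L i.Ω l) → SockLettersRD (𝔸 := θ.toStage3Params.𝔸) θ.toStage3Params.L BG BR B₀'H B₂' cL i.η i.k i.Ω i.Λs)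
    (SLetUB : ∀ i : ZdIdx θ.toStage3Params.D θ.toStage3Params.L, i.Ω 0 = Set.univ → IdxB8LawsB θ.toStage3Params.L i → B8ConstraintBonds.DomainSeq θ.toStage3Params.L i.Ω → (∀ l, l < i.k → ∀ z ∈ i.Λs i.k l, ((θ.toStage3Params.L : ℤ) ^ l) • z ∈ B8ConstraintBonds.Lam θ.toStage3Params.L i.Ω l) → ∀ α₀ : ℝ, 0 < α₀ → α₀ ≤ cL → ∀ U₀ : Site θ.toStage3Params.D → Fin θ.toStage3Params.D → θ.toStage3Params.𝔸ˣ, (∀ x κ, U₀ x κ ∈ unitaryUnits θ.toStage3Params.𝔸) →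
      InAk θ.toStage3Params.L i.k i.η α₀ i.Ω U₀ →
      ∃ (g Δ : (Site θ.toStage3Params.D → θ.toStage3Params.𝔸) →ₗ[ℂ] (Site θ.toStage3Params.D → θ.toStage3Params.𝔸)) (q : (Site θ.toStage3Params.D → θ.toStage3Params.𝔸) →ₗ[ℂ] (ℕ → Site θ.toStage3Params.D → θ.toStage3Params.𝔸))
        (qs : (ℕ → Site θ.toStage3Params.D → θ.toStage3Params.𝔸) →ₗ[ℂ] (Site θ.toStage3Params.D → θ.toStage3Params.𝔸)) (Aw c : (ℕ → Site θ.toStage3Params.D → θ.toStage3Params.𝔸) →ₗ[ℂ] (ℕ → Site θ.toStage3Params.D → θ.toStage3Params.𝔸))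
        (H' : XSpace θ.toStage3Params.D i.k θ.toStage3Params.𝔸 →ₗ[ℂ] (Site θ.toStage3Params.D → θ.toStage3Params.𝔸)),
        (∀ x : Site θ.toStage3Params.D → θ.toStage3Params.𝔸, (∃ C : ℝ, ∀ y, ‖x y‖ ≤ C) → g (Δ x + qs (Aw (q x))) = x) ∧ (∀ φ, qs (c (q (g (g (qs φ))))) = qs φ) ∧
        (∀ (f : Site θ.toStage3Params.D → θ.toStage3Params.𝔸), ∀ x ∈ i.Ω 0, Δ f x = covLap i.η U₀ ((i.Ω 0).indicator f) x) ∧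
        (∀ (μ : ℕ → Site θ.toStage3Params.D → θ.toStage3Params.𝔸), ∀ x ∈ i.Ω 0, qs μ x = QT θ.toStage3Params.L i.k (i.Λs i.k) U₀ μ x) ∧
        (∀ (f : Site θ.toStage3Params.D → θ.toStage3Params.𝔸) (n : ℕ), n ≤ i.k → ∀ y ∈ i.Λs i.k n, q f n y = QprimeIter (zdBlocking θ.toStage3Params.D θ.toStage3Params.L) (bgT θ.toStage3Params.L U₀) n f y) ∧
        (∀ (f : Site θ.toStage3Params.D → θ.toStage3Params.𝔸) (n : ℕ) (y : Site θ.toStage3Params.D), ¬ (n ≤ i.k ∧ y ∈ i.Λs i.k n) → q f n y = 0) ∧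
        (∀ (X : XSpace θ.toStage3Params.D i.k θ.toStage3Params.𝔸) (x : Site θ.toStage3Params.D), ‖H' X x‖ ≤ B₀'H * ‖X‖) ∧
        (∀ n, n ≤ i.k → ∀ (X : XSpace θ.toStage3Params.D i.k θ.toStage3Params.𝔸), ∀ p ∈ {b : Site θ.toStage3Params.D × Fin θ.toStage3Params.D | SideTouches (i.Ω n) b.1 b.2},
          wt θ.toStage3Params.L i.η n * ‖covDerivFwd i.η U₀ p.2 (H' X) p.1‖ ≤ B₀'H * ‖X‖) ∧
        (∀ X : XSpace θ.toStage3Params.D i.k θ.toStage3Params.𝔸, Bd2 θ.toStage3Params.L i.η i.k i.Ω (covLap i.η U₀ (H' X)) (B₂' * ‖X‖)) ∧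
        (∀ (Y : XSpace θ.toStage3Params.D i.k θ.toStage3Params.𝔸) (n : ℕ) (hn : n ≤ i.k) (y : Site θ.toStage3Params.D), y ∈ i.Λs i.k n →
          QprimeIter (zdBlocking θ.toStage3Params.D θ.toStage3Params.L) (bgT θ.toStage3Params.L U₀) n (H' Y) y = Y (⟨n, Nat.lt_succ_of_le hn⟩, y)) ∧
        (∀ (f : Site θ.toStage3Params.D → θ.toStage3Params.𝔸) (r : ℝ), 0 ≤ r → Bd2 θ.toStage3Params.L i.η i.k i.Ω f r →
          (∀ x, ‖g f x‖ ≤ BG * r) ∧ ∀ n, n ≤ i.k → ∀ p ∈ {b : Site θ.toStage3Params.D × Fin θ.toStage3Params.D | SideTouches (i.Ω n) b.1 b.2},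
            wt θ.toStage3Params.L i.η n * ‖covDerivFwd i.η U₀ p.2 (g f) p.1‖ ≤ BG * r) ∧
        (∀ (f : Site θ.toStage3Params.D → θ.toStage3Params.𝔸) (r : ℝ), 0 ≤ r → Bd2 θ.toStage3Params.L i.η i.k i.Ω f r → Bd2 θ.toStage3Params.L i.η i.k i.Ω (f - g (qs (c (q (g f))))) (BR * r)))
    -- N06's FRAME for [4] Thm 3.3 (any index type, geometries, backgrounds, the two kernel families of Thms 3.1–3.3) and its `ℤᵈ` dictionary maps
    {I : Type} (geo : I → B9.Geometry) (bg : I → B9.Backgrounds) (Gp GA : ∀ i, B9.KernelFamily (geo i) (bg i))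
    (mem : ℝ → ZdIdx θ.toStage3Params.D θ.toStage3Params.L → ℕ → I)
    (ιCfg : ∀ (M : ℝ) (i : ZdIdx θ.toStage3Params.D θ.toStage3Params.L) (m : ℕ) (U₀ : Site θ.toStage3Params.D → Fin θ.toStage3Params.D → θ.toStage3Params.𝔸ˣ), (∀ x κ, U₀ x κ ∈ unitaryUnits θ.toStage3Params.𝔸) → (bg (mem M i m)).Cfg)
    (ιLoc : ∀ (M : ℝ) (i : ZdIdx θ.toStage3Params.D θ.toStage3Params.L) (m : ℕ), (Site θ.toStage3Params.D → Fin θ.toStage3Params.D → θ.toStage3Params.𝔸) → (geo (mem M i m)).Loc)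
    (ops : ℝ → ZdIdx θ.toStage3Params.D θ.toStage3Params.L → ℕ → OpsZd θ.toStage3Params.D θ.toStage3Params.𝔸)
    {c35 c₆ K₆ M₃ a₃ c69 q β cS cSβ : ℝ} {CH : ℝ → ℝ} {len : Site θ.toStage3Params.D → ℝ}
    -- N06's THEOREM 3.3 AS PRINTED, by name
    (h33 : B9.Thm33Printed c35 geo bg Gp GA)
    -- dag-n06-b's JUNCTION DICTIONARY BINDERS at the (1.3)–(1.5)-admissible members, guarded (N06 object layer; HYPOTHESES)
    (hdict : ∀ (M : ℝ) (j : IdxB8SubD θ.toStage3Params) (m : ℕ), 1 ≤ M → M₃ ≤ M → m ≤ j.1.1.1.1.k → DictAt geo bg GA θ.toStage3Params.L mem ιCfg ιLoc ops M j.1.1.1.1 m)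
    (hP6 : ∀ (M : ℝ) (j : IdxB8SubD θ.toStage3Params) (m : ℕ), 1 ≤ M → M₃ ≤ M → m ≤ j.1.1.1.1.k → Prop6At bg θ.toStage3Params.L mem ιCfg c35 c₆ K₆ M j.1.1.1.1 m)
    (hinv : ∀ (M : ℝ) (j : IdxB8SubD θ.toStage3Params) (m : ℕ), 1 ≤ M → M₃ ≤ M → m ≤ j.1.1.1.1.k → InvAtH bg θ.toStage3Params.L mem ιCfg ops c35 a₃ M j.1.1.1.1 m)
    (hcurv : ∀ (M : ℝ) (j : IdxB8SubD θ.toStage3Params) (m : ℕ), 1 ≤ M → M₃ ≤ M → m ≤ j.1.1.1.1.k → CurvAtInAk θ.toStage3Params.L ops c69 M j.1.1.1.1 m)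
    (hlan : ∀ (M : ℝ) (j : IdxB8SubD θ.toStage3Params) (m : ℕ), 1 ≤ M → M₃ ≤ M → m ≤ j.1.1.1.1.k → LandauAt bg θ.toStage3Params.L mem ιCfg ops c35 a₃ M j.1.1.1.1 m)
    (havg : ∀ (M : ℝ) (j : IdxB8SubD θ.toStage3Params) (m : ℕ), 1 ≤ M → M₃ ≤ M → m ≤ j.1.1.1.1.k →
      AvgAtP θ.toStage3Params.L ops q (fun m' l => towerBondsP θ.toStage3Params.L j.1.1.1.1.Ω (j.1.1.1.1.Λs m') l) M j.1.1.1.1 m)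
    (hhol : ∀ (M : ℝ) (j : IdxB8SubD θ.toStage3Params) (m : ℕ), 1 ≤ M → M₃ ≤ M → m ≤ j.1.1.1.1.k → HolderAtδ2 geo bg GA θ.toStage3Params.L mem ιCfg ops β len CH M j.1.1.1.1 m)
    (hlin : ∀ (M : ℝ) (j : IdxB8SubD θ.toStage3Params) (m : ℕ), 1 ≤ M → M₃ ≤ M → m ≤ j.1.1.1.1.k → LinBddAt θ.toStage3Params.L ops M j.1.1.1.1 m)
    (hsrc : ∀ (M : ℝ) (j : IdxB8SubD θ.toStage3Params) (m : ℕ), 1 ≤ M → M₃ ≤ M → m ≤ j.1.1.1.1.k → SrcAt bg θ.toStage3Params.L mem ιCfg ops c35 a₃ cS M j.1.1.1.1 m)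
    (hsrcH : ∀ (M : ℝ) (j : IdxB8SubD θ.toStage3Params) (m : ℕ), 1 ≤ M → M₃ ≤ M → m ≤ j.1.1.1.1.k → SrcHolderAtδ2 bg θ.toStage3Params.L mem ιCfg ops c35 a₃ β len cSβ M j.1.1.1.1 m)
    -- the junction's primitive constants ([4] (3.35)∕Prop. 6 `c₆ K₆`, (3.27) `a₃`, (3.69) `c69`, (3.16) `q`, source `c_S c_Sβ`) and Theorem 8's source size factor `γ₈`
    (hc₆ : 0 < c₆) (hK₆ : 0 < K₆) (ha₃ : 0 < a₃) (hc69 : 0 ≤ c69) (hq : 0 ≤ q) (hcS : 0 ≤ cS) (hcSβ : 0 ≤ cSβ) {γ₈ : ℝ} (hγ₈ : 1 ≤ γ₈) :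
    ∃ (lam : ResidB8 θ.toStage3Params) (c₁ : ℝ) (ρ₀ : ℕ) (w : WorldP), IsRecordOfRecord₁₃CSepCoPHG F N (datumOfRecord₁₃SepCoPH F N θ h) w ∧ w.γ = γw ∧
      (∀ P : B12.RunParams, w.up P = upOfRecord₅CSC F N ((θ.pinB8SubBP₂D F N (lam.cutSubBP₅ c₁ ρ₀)).toStage5₁₃CoPH F N) (c₇OfRecord θ.toStage3Params) P) ∧
      ∀ P : B12.RunParams, (leavesP w P).b8 ∧ Dag.B8_main (leavesP w P) := by
  obtain ⟨lam, c₁, ρ₀, w, -, hw, -, hγ, -, hup, hmain, -⟩ := exists_isRecordOfRecord₁₃CSepCoPHSB8subBP₂D_b8_of_letters_thm33_junctionH θ h hθ hL5 hγ0 hγ1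
    hB₀'H hB₂' hBG hBR hcL SLet SLetUB geo bg Gp GA mem ιCfg ιLoc ops h33 hdict hP6 hinv hcurv hlan havg hhol hlin hsrc hsrcH hc₆ hK₆ ha₃ hc69 hq hcS hcSβ hγ₈
  exact ⟨lam, c₁, ρ₀, w, isRecordOfRecord₁₃CSepCoPHG_of_isRecordOfRecord₁₃CSepCoPHSB8subBP₂D hw, hγ, hup, hmain⟩

/-- ★ **… IN THE `b8`-GENERIC S-CLASS, GENUINE AVERAGING LETTER** (FILE C's row).  `Thm33Printed`, the junction binders and [4] Thm 3.1's letters are HYPOTHESES (N06 content, m ≥ 1 OPEN); N05 NOT discharged.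
[cite: Balaban1985RegularSpaces, Lemma 1 – Thm 8 pp.79–101, (1.31) p.82; Balaban1985BackgroundPropagators, (3.16) p.393, Thm 3.1 p.397, Thm 3.3 p.399; Balaban1989LargeFieldII, Thm 1 + (0.1) pp.355–356 (bookkeeping)] -/
theorem exists_isRecordOfRecord₁₃CSepCoPHG_b8_of_letters_thm33_junctionH_withQQP (θ : Stage13HParams F N) (h : θ.Provisos₁₃SepCoPH F N) (hθ : θ.Admissible F N)
    (hL5 : 5 ≤ θ.toStage3Params.L) {γw : ℝ} (hγ0 : 0 < γw) (hγ1 : γw ≤ θ.γ)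
    -- [Balaban1985BackgroundPropagators] Thm 3.1's letter bounds and threshold
    {B₀'H B₂' BG BR cL : ℝ} (hB₀'H : 0 < B₀'H) (hB₂' : 0 ≤ B₂') (hBG : 0 ≤ BG) (hBR : 0 ≤ BR) (hcL : 0 < cL)
    -- [4]'s letters AT THE (1.3)–(1.5)-ADMISSIBLE `Ω₀ = ℤᵈ` LAW MEMBERS (p619291's texts verbatim): existence side and uniqueness side
    (SLet : ∀ i : ZdIdx θ.toStage3Params.D θ.toStage3Params.L, i.Ω 0 = Set.univ → IdxB8LawsB θ.toStage3Params.L i → B8ConstraintBonds.DomainSeq θ.toStage3Params.L i.Ω → (∀ l, l < i.k → ∀ z ∈ i.Λs i.k l, ((θ.toStage3Params.L : ℤ) ^ l) • z ∈ B8ConstraintBonds.Lam θ.toStage3Params.L i.Ω l) → SockLettersRD (𝔸 := θ.toStage3Params.𝔸) θ.toStage3Params.L BG BR B₀'H B₂' cL i.η i.k i.Ω i.Λs)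
    (SLetUB : ∀ i : ZdIdx θ.toStage3Params.D θ.toStage3Params.L, i.Ω 0 = Set.univ → IdxB8LawsB θ.toStage3Params.L i → B8ConstraintBonds.DomainSeq θ.toStage3Params.L i.Ω → (∀ l, l < i.k → ∀ z ∈ i.Λs i.k l, ((θ.toStage3Params.L : ℤ) ^ l) • z ∈ B8ConstraintBonds.Lam θ.toStage3Params.L i.Ω l) → ∀ α₀ : ℝ, 0 < α₀ → α₀ ≤ cL → ∀ U₀ : Site θ.toStage3Params.D → Fin θ.toStage3Params.D → θ.toStage3Params.𝔸ˣ, (∀ x κ, U₀ x κ ∈ unitaryUnits θ.toStage3Params.𝔸) →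
      InAk θ.toStage3Params.L i.k i.η α₀ i.Ω U₀ →
      ∃ (g Δ : (Site θ.toStage3Params.D → θ.toStage3Params.𝔸) →ₗ[ℂ] (Site θ.toStage3Params.D → θ.toStage3Params.𝔸)) (q : (Site θ.toStage3Params.D → θ.toStage3Params.𝔸) →ₗ[ℂ] (ℕ → Site θ.toStage3Params.D → θ.toStage3Params.𝔸))
        (qs : (ℕ → Site θ.toStage3Params.D → θ.toStage3Params.𝔸) →ₗ[ℂ] (Site θ.toStage3Params.D → θ.toStage3Params.𝔸)) (Aw c : (ℕ → Site θ.toStage3Params.D → θ.toStage3Params.𝔸) →ₗ[ℂ] (ℕ → Site θ.toStage3Params.D → θ.toStage3Params.𝔸))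
        (H' : XSpace θ.toStage3Params.D i.k θ.toStage3Params.𝔸 →ₗ[ℂ] (Site θ.toStage3Params.D → θ.toStage3Params.𝔸)),
        (∀ x : Site θ.toStage3Params.D → θ.toStage3Params.𝔸, (∃ C : ℝ, ∀ y, ‖x y‖ ≤ C) → g (Δ x + qs (Aw (q x))) = x) ∧ (∀ φ, qs (c (q (g (g (qs φ))))) = qs φ) ∧
        (∀ (f : Site θ.toStage3Params.D → θ.toStage3Params.𝔸), ∀ x ∈ i.Ω 0, Δ f x = covLap i.η U₀ ((i.Ω 0).indicator f) x) ∧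
        (∀ (μ : ℕ → Site θ.toStage3Params.D → θ.toStage3Params.𝔸), ∀ x ∈ i.Ω 0, qs μ x = QT θ.toStage3Params.L i.k (i.Λs i.k) U₀ μ x) ∧
        (∀ (f : Site θ.toStage3Params.D → θ.toStage3Params.𝔸) (n : ℕ), n ≤ i.k → ∀ y ∈ i.Λs i.k n, q f n y = QprimeIter (zdBlocking θ.toStage3Params.D θ.toStage3Params.L) (bgT θ.toStage3Params.L U₀) n f y) ∧
        (∀ (f : Site θ.toStage3Params.D → θ.toStage3Params.𝔸) (n : ℕ) (y : Site θ.toStage3Params.D), ¬ (n ≤ i.k ∧ y ∈ i.Λs i.k n) → q f n y = 0) ∧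
        (∀ (X : XSpace θ.toStage3Params.D i.k θ.toStage3Params.𝔸) (x : Site θ.toStage3Params.D), ‖H' X x‖ ≤ B₀'H * ‖X‖) ∧
        (∀ n, n ≤ i.k → ∀ (X : XSpace θ.toStage3Params.D i.k θ.toStage3Params.𝔸), ∀ p ∈ {b : Site θ.toStage3Params.D × Fin θ.toStage3Params.D | SideTouches (i.Ω n) b.1 b.2},
          wt θ.toStage3Params.L i.η n * ‖covDerivFwd i.η U₀ p.2 (H' X) p.1‖ ≤ B₀'H * ‖X‖) ∧
        (∀ X : XSpace θ.toStage3Params.D i.k θ.toStage3Params.𝔸, Bd2 θ.toStage3Params.L i.η i.k i.Ω (covLap i.η U₀ (H' X)) (B₂' * ‖X‖)) ∧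
        (∀ (Y : XSpace θ.toStage3Params.D i.k θ.toStage3Params.𝔸) (n : ℕ) (hn : n ≤ i.k) (y : Site θ.toStage3Params.D), y ∈ i.Λs i.k n →
          QprimeIter (zdBlocking θ.toStage3Params.D θ.toStage3Params.L) (bgT θ.toStage3Params.L U₀) n (H' Y) y = Y (⟨n, Nat.lt_succ_of_le hn⟩, y)) ∧
        (∀ (f : Site θ.toStage3Params.D → θ.toStage3Params.𝔸) (r : ℝ), 0 ≤ r → Bd2 θ.toStage3Params.L i.η i.k i.Ω f r →
          (∀ x, ‖g f x‖ ≤ BG * r) ∧ ∀ n, n ≤ i.k → ∀ p ∈ {b : Site θ.toStage3Params.D × Fin θ.toStage3Params.D | SideTouches (i.Ω n) b.1 b.2},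
            wt θ.toStage3Params.L i.η n * ‖covDerivFwd i.η U₀ p.2 (g f) p.1‖ ≤ BG * r) ∧
        (∀ (f : Site θ.toStage3Params.D → θ.toStage3Params.𝔸) (r : ℝ), 0 ≤ r → Bd2 θ.toStage3Params.L i.η i.k i.Ω f r → Bd2 θ.toStage3Params.L i.η i.k i.Ω (f - g (qs (c (q (g f))))) (BR * r)))
    -- N06's FRAME for [4] Thm 3.3 (any index type, geometries, backgrounds, the two kernel families of Thms 3.1–3.3) and its `ℤᵈ` dictionary maps
    {I : Type} (geo : I → B9.Geometry) (bg : I → B9.Backgrounds) (Gp GA : ∀ i, B9.KernelFamily (geo i) (bg i))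
    (mem : ℝ → ZdIdx θ.toStage3Params.D θ.toStage3Params.L → ℕ → I)
    (ιCfg : ∀ (M : ℝ) (i : ZdIdx θ.toStage3Params.D θ.toStage3Params.L) (m : ℕ) (U₀ : Site θ.toStage3Params.D → Fin θ.toStage3Params.D → θ.toStage3Params.𝔸ˣ), (∀ x κ, U₀ x κ ∈ unitaryUnits θ.toStage3Params.𝔸) → (bg (mem M i m)).Cfg)
    (ιLoc : ∀ (M : ℝ) (i : ZdIdx θ.toStage3Params.D θ.toStage3Params.L) (m : ℕ), (Site θ.toStage3Params.D → Fin θ.toStage3Params.D → θ.toStage3Params.𝔸) → (geo (mem M i m)).Loc)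
    (ops : ℝ → ZdIdx θ.toStage3Params.D θ.toStage3Params.L → ℕ → OpsZd θ.toStage3Params.D θ.toStage3Params.𝔸)
    -- THE GENUINE AVERAGING LETTER: `ops` carries dag-n06-b's `withQQP` co-letter `(Q*Q)(U₀)` at print's class of the member ([4] (3.16); trace functional `τ`)
    [FiniteDimensional ℝ θ.toStage3Params.𝔸] (τ : θ.toStage3Params.𝔸 →ₗ[ℂ] ℂ) {Cτ : ℝ} (hCτ : ∀ x y : θ.toStage3Params.𝔸, |(τ (star x * y)).re| ≤ Cτ * ‖x‖ * ‖y‖)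
    (ops₀ : ℝ → ZdIdx θ.toStage3Params.D θ.toStage3Params.L → ℕ → OpsZd θ.toStage3Params.D θ.toStage3Params.𝔸)
    (hops : ∀ (M : ℝ) (i : ZdIdx θ.toStage3Params.D θ.toStage3Params.L) (m : ℕ), ops M i m = withQQP τ θ.toStage3Params.L (fun m' l => towerBondsP θ.toStage3Params.L i.Ω (i.Λs m') l) ops₀ M i m)
    {c35 c₆ K₆ M₃ a₃ c69 β cS cSβ : ℝ} {CH : ℝ → ℝ} {len : Site θ.toStage3Params.D → ℝ}
    -- N06's THEOREM 3.3 AS PRINTED, by name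
    (h33 : B9.Thm33Printed c35 geo bg Gp GA)
    -- dag-n06-b's JUNCTION DICTIONARY BINDERS at the (1.3)–(1.5)-admissible members, guarded (N06 object layer; HYPOTHESES) — NO `havg`
    (hdict : ∀ (M : ℝ) (j : IdxB8SubD θ.toStage3Params) (m : ℕ), 1 ≤ M → M₃ ≤ M → m ≤ j.1.1.1.1.k → DictAt geo bg GA θ.toStage3Params.L mem ιCfg ιLoc ops M j.1.1.1.1 m)
    (hP6 : ∀ (M : ℝ) (j : IdxB8SubD θ.toStage3Params) (m : ℕ), 1 ≤ M → M₃ ≤ M → m ≤ j.1.1.1.1.k → Prop6At bg θ.toStage3Params.L mem ιCfg c35 c₆ K₆ M j.1.1.1.1 m)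
    (hinv : ∀ (M : ℝ) (j : IdxB8SubD θ.toStage3Params) (m : ℕ), 1 ≤ M → M₃ ≤ M → m ≤ j.1.1.1.1.k → InvAtH bg θ.toStage3Params.L mem ιCfg ops c35 a₃ M j.1.1.1.1 m)
    (hcurv : ∀ (M : ℝ) (j : IdxB8SubD θ.toStage3Params) (m : ℕ), 1 ≤ M → M₃ ≤ M → m ≤ j.1.1.1.1.k → CurvAtInAk θ.toStage3Params.L ops c69 M j.1.1.1.1 m)
    (hlan : ∀ (M : ℝ) (j : IdxB8SubD θ.toStage3Params) (m : ℕ), 1 ≤ M → M₃ ≤ M → m ≤ j.1.1.1.1.k → LandauAt bg θ.toStage3Params.L mem ιCfg ops c35 a₃ M j.1.1.1.1 m)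
    (hhol : ∀ (M : ℝ) (j : IdxB8SubD θ.toStage3Params) (m : ℕ), 1 ≤ M → M₃ ≤ M → m ≤ j.1.1.1.1.k → HolderAtδ2 geo bg GA θ.toStage3Params.L mem ιCfg ops β len CH M j.1.1.1.1 m)
    (hlin : ∀ (M : ℝ) (j : IdxB8SubD θ.toStage3Params) (m : ℕ), 1 ≤ M → M₃ ≤ M → m ≤ j.1.1.1.1.k → LinBddAt θ.toStage3Params.L ops M j.1.1.1.1 m)
    (hsrc : ∀ (M : ℝ) (j : IdxB8SubD θ.toStage3Params) (m : ℕ), 1 ≤ M → M₃ ≤ M → m ≤ j.1.1.1.1.k → SrcAt bg θ.toStage3Params.L mem ιCfg ops c35 a₃ cS M j.1.1.1.1 m)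
    (hsrcH : ∀ (M : ℝ) (j : IdxB8SubD θ.toStage3Params) (m : ℕ), 1 ≤ M → M₃ ≤ M → m ≤ j.1.1.1.1.k → SrcHolderAtδ2 bg θ.toStage3Params.L mem ιCfg ops c35 a₃ β len cSβ M j.1.1.1.1 m)
    -- the junction's primitive constants ([4] (3.35)∕Prop. 6 `c₆ K₆`, (3.27) `a₃`, (3.69) `c69`, source `c_S c_Sβ`) and Theorem 8's source size factor `γ₈`
    (hc₆ : 0 < c₆) (hK₆ : 0 < K₆) (ha₃ : 0 < a₃) (hc69 : 0 ≤ c69) (hcS : 0 ≤ cS) (hcSβ : 0 ≤ cSβ) {γ₈ : ℝ} (hγ₈ : 1 ≤ γ₈) :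
    ∃ (lam : ResidB8 θ.toStage3Params) (c₁ : ℝ) (ρ₀ : ℕ) (w : WorldP), IsRecordOfRecord₁₃CSepCoPHG F N (datumOfRecord₁₃SepCoPH F N θ h) w ∧ w.γ = γw ∧
      (∀ P : B12.RunParams, w.up P = upOfRecord₅CSC F N ((θ.pinB8SubBP₂D F N (lam.cutSubBP₅ c₁ ρ₀)).toStage5₁₃CoPH F N) (c₇OfRecord θ.toStage3Params) P) ∧
      ∀ P : B12.RunParams, (leavesP w P).b8 ∧ Dag.B8_main (leavesP w P) := by
  obtain ⟨lam, c₁, ρ₀, w, -, hw, -, hγ, -, hup, hmain, -⟩ := exists_isRecordOfRecord₁₃CSepCoPHSB8subBP₂D_b8_of_letters_thm33_junctionH_withQQP θ h hθ hL5 hγ0 hγ1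
    hB₀'H hB₂' hBG hBR hcL SLet SLetUB geo bg Gp GA mem ιCfg ιLoc ops τ hCτ ops₀ hops h33 hdict hP6 hinv hcurv hlan hhol hlin hsrc hsrcH hc₆ hK₆ ha₃ hc69 hcS hcSβ hγ₈
  exact ⟨lam, c₁, ρ₀, w, isRecordOfRecord₁₃CSepCoPHG_of_isRecordOfRecord₁₃CSepCoPHSB8subBP₂D hw, hγ, hup, hmain⟩

end AtRecordG

end Summit.QuantumFields.YangMills.BalabanUVNodes.N05AtRecord13SubBP2DSepCoPHOfThm33JunctionH

end
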